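import Summits.AtomisticToContinuum.HydrodynamicLimit.Theorems.OneFlightGossipEngineEnergyCurrentTailsLevelCensusClosureTools
import Summits.AtomisticToContinuum.HydrodynamicLimit.Theorems.OneFlightGossipEngineEnergyCurrentTailsLevelCensusClosureEvents
import HarnessLib

/-!
# Census closure, frame: the conditional decrease of the census at a near-touching level
# (stub C of the line `level-census-comparison`, crux `EnergyCurrentTails`, stmt-AtomisticToContinuum-9235)

Helper file of the registered stub `stub_censusClosure` (line lead's seat c2; registered main
theorem `closure_hdec`, `∀`-form).  The measure-theoretic glue between the flux inequalities of the
stubs (A: crossing ledger + a.e.-measurability, F1: shell/tail ceilings, F2: merge ceiling, F3: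
splitting floor — all taken here as HYPOTHESES at one window `(u, r']` and one level `E`, in the
literal shape of the `Prop`s of `…LevelCensusObjects`) and the real supersolution inequality of
`…LevelCensusClosureCore` (also a hypothesis here, `hsuper`): if an abstract majorant `nhi`
dominates the census on the window, `nE` minorises it at the level `E`, and
`band + pairs + C₁·(every partial dyadic tail sum) ≤ decay`, then the expected number of
up-crossings at `E` in the window is at most the expected number of down-crossings, so by the
ledger `n_{r'}(E) ≤ n_u(E)` (`closure_hdec`).  The same glue with CRUDE bounds (census `≤ N+1`,
pair majorant `≤ (N+1)²·#classes`, Chebyshev for the speed census) gives the upward time-Lipschitz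
estimate `closure_hlip`.
`ℝ≥0∞` bookkeeping: every census is finite under the probability law `λ_N`; sups over the window
are bounded by `iSup₂_le`, the inf of F3 by `le_iInf₂`; the dyadic layer cake is an `ℝ≥0∞`-`tsum`,
bounded through its partial sums (`ENNReal.tsum_eq_iSup_nat`).
-/

noncomputable section

open MeasureTheory Set Filter
open scoped ENNReal InnerProductSpace

namespace Summit.AtomisticToContinuum.HydrodynamicLimit.Theorems.EnergyCurrentTailsLevelCensus

open Literature.MathematicalPhysics.KineticTheory Literature.Analysis.FluidPDE

variable {σ : ℝ} {a₀ θ₀ : T3 → ℝ} {u₀ : T3 → V3} {N : ℕ}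

/-! ## `ℝ≥0∞` glue -/

/-- A flux bounded by `ofReal a · sup_{r ∈ [s,s']} X r` with `X r ≤ ofReal x` on the window is
`≤ ofReal (a x)`. -/
theorem flux_le_of_iSup_le {a x s s' : ℝ} (ha : 0 ≤ a) {X : ℝ → ℝ≥0∞} {Fl : ℝ≥0∞}
    (hFl : Fl ≤ ENNReal.ofReal a * ⨆ r ∈ Set.Icc s s', X r)
    (hX : ∀ r ∈ Set.Icc s s', X r ≤ ENNReal.ofReal x) : Fl ≤ ENNReal.ofReal (a * x) := by
  rw [ENNReal.ofReal_mul ha]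
  exact hFl.trans (mul_le_mul' le_rfl (iSup₂_le hX))

/-- A flux minorised by `ofReal a · inf_{r ∈ [s,s']} X r` with `ofReal x ≤ X r` on the window is
`≥ ofReal (a x)`. -/
theorem ofReal_le_flux_of_le_iInf {a x s s' : ℝ} (ha : 0 ≤ a) {X : ℝ → ℝ≥0∞} {Fl : ℝ≥0∞}
    (hFl : ENNReal.ofReal a * (⨅ r ∈ Set.Icc s s', X r) ≤ Fl)
    (hX : ∀ r ∈ Set.Icc s s', ENNReal.ofReal x ≤ X r) : ENNReal.ofReal (a * x) ≤ Fl := by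
  rw [ENNReal.ofReal_mul ha]
  exact (mul_le_mul' le_rfl (le_iInf₂ hX)).trans hFl

/-- `(N + 1 : ℕ)` in `ℝ≥0∞` is `ofReal (N + 1)`. -/
theorem natCast_succ_eq_ofReal (N : ℕ) : ((N + 1 : ℕ) : ℝ≥0∞) = ENNReal.ofReal ((N : ℝ) + 1) := by
  rw [show ((N : ℝ) + 1) = ((N + 1 : ℕ) : ℝ) by push_cast; ring, ENNReal.ofReal_natCast]

/-- A finite census, bounded in `toReal` form, is bounded in `ℝ≥0∞`. -/
theorem le_ofReal_of_toReal_le {X : ℝ≥0∞} (hX : X ≠ ⊤) {x : ℝ} (h : X.toReal ≤ x) :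
    X ≤ ENNReal.ofReal x := by
  rw [← ENNReal.ofReal_toReal hX]; exact ENNReal.ofReal_le_ofReal h

/-- A finite census, minorised in `toReal` form, is minorised in `ℝ≥0∞`. -/
theorem ofReal_le_of_le_toReal {X : ℝ≥0∞} (hX : X ≠ ⊤) {x : ℝ} (h : x ≤ X.toReal) :
    ENNReal.ofReal x ≤ X := by
  rw [← ENNReal.ofReal_toReal hX]; exact ENNReal.ofReal_le_ofReal h

/-! ## The dyadic tail through its partial sums -/

/-- If every partial sum of the dyadic layer-cake majorant of `nhi` at `Y` is `≤ x`, and `nhi`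
dominates the census at time `r`, then `speed_r(Y) ≤ ofReal x` (`Y > 0`). -/
theorem speedCensus_le_ofReal_of_partial (Φ : Flow σ N)
    [IsProbabilityMeasure (localGibbsLaw σ a₀ u₀ θ₀ N Φ)] (r : ℝ) {Y x : ℝ} (hY : 0 < Y)
    {nhi : ℝ → ℝ} (h0 : ∀ E', 0 ≤ nhi E')
    (hn : ∀ E', (levelCensus σ a₀ θ₀ u₀ N Φ r E').toReal ≤ nhi E')
    (hx : ∀ K : ℕ, ∑ k ∈ Finset.range K, Real.sqrt (2 ^ (k + 1) * Y) * nhi (2 ^ k * Y) ≤ x) :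
    speedCensus σ a₀ θ₀ u₀ N Φ r Y ≤ ENNReal.ofReal x := by
  refine (speedCensus_le_tsum_shellCensus Φ r hY).trans ?_
  have hterm : ∀ k : ℕ, ENNReal.ofReal (Real.sqrt (2 ^ (k + 1) * Y)) *
      shellCensus σ a₀ θ₀ u₀ N Φ r (2 ^ k * Y) (2 ^ (k + 1) * Y)
      ≤ ENNReal.ofReal (Real.sqrt (2 ^ (k + 1) * Y) * nhi (2 ^ k * Y)) := by
    intro k
    rw [ENNReal.ofReal_mul (Real.sqrt_nonneg _)]
    refine mul_le_mul' le_rfl ((shellCensus_le_levelCensus Φ r _ _).trans ?_)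
    exact le_ofReal_of_toReal_le (levelCensus_ne_top Φ r _) (hn _)
  refine (ENNReal.tsum_le_tsum hterm).trans ?_
  rw [ENNReal.tsum_eq_iSup_nat]
  refine iSup_le fun K => ?_
  rw [← ENNReal.ofReal_sum_of_nonneg fun k _ => mul_nonneg (Real.sqrt_nonneg _) (h0 _)]
  exact ENNReal.ofReal_le_ofReal (hx K)

/-! ## The conditional decrease (registered main theorem of this file) -/

/-- **Conditional decrease of the census at a near-touching level (`∀`-form).**  Fix a window
`(u, r']` and a level `E > 0` with band width `0 < Δ ≤ E`.  Assume the flux inequalities of F1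
(shell at `(E−Δ, E]`, tail at `4E`), F2 (merge at `E`), F3 (splitting at `E`) on this window, the
crossing ledger of A at `(u, r', E)`, the a.e.-measurability of the merge and tail counts, an
abstract majorant `nhi ≥ 0` of the census on the window with a minorant `nE` at the level `E`, and
the supersolution inequality for every partial tail sum.  Then `n_{r'}(E) ≤ n_u(E)`. -/
theorem closure_hdec :
    ∀ (σ : ℝ) (a₀ θ₀ : T3 → ℝ) (u₀ : T3 → V3) (N : ℕ) (Φ : Flow σ N)
      (C₁ A c κ E Δ u r' nE : ℝ) (nhi : ℝ → ℝ),
      IsProbabilityMeasure (localGibbsLaw σ a₀ u₀ θ₀ N Φ) →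
      0 < C₁ → 0 ≤ A → 0 ≤ c → 0 < κ → u < r' → 0 < E → 0 < Δ → Δ ≤ E →
      (∀ E', 0 ≤ nhi E') →
      (∀ r ∈ Set.Icc u r', ∀ E', (levelCensus σ a₀ θ₀ u₀ N Φ r E').toReal ≤ nhi E') →
      (∀ r ∈ Set.Icc u r', nE ≤ (levelCensus σ a₀ θ₀ u₀ N Φ r E).toReal) →
      eventCount σ a₀ θ₀ u₀ N Φ u r' (shellEvent (E - Δ) E)
        ≤ ENNReal.ofReal (C₁ * κ * Real.sqrt E * (r' - u)) *
            ⨆ r ∈ Set.Icc u r', shellCensus σ a₀ θ₀ u₀ N Φ r (E - Δ) E →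
      eventCount σ a₀ θ₀ u₀ N Φ u r' (mergeEvent E Δ)
        ≤ ENNReal.ofReal (A * κ * Real.sqrt E * (r' - u) / ((N : ℝ) + 1)) *
            ⨆ r ∈ Set.Icc u r', pairMajorant σ a₀ θ₀ u₀ N Φ r E Δ →
      eventCount σ a₀ θ₀ u₀ N Φ u r' (tailEvent (4 * E))
        ≤ ENNReal.ofReal (C₁ * κ * (r' - u)) *
            ⨆ r ∈ Set.Icc u r', speedCensus σ a₀ θ₀ u₀ N Φ r (4 * E) →
      ENNReal.ofReal (c * κ * Real.sqrt E * (r' - u)) *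
          (⨅ r ∈ Set.Icc u r', shellCensus σ a₀ θ₀ u₀ N Φ r E (3 / 2 * E))
        ≤ eventCount σ a₀ θ₀ u₀ N Φ u r' (splitEvent E) →
      levelCensus σ a₀ θ₀ u₀ N Φ r' E + eventCount σ a₀ θ₀ u₀ N Φ u r' (downEvent E)
        = levelCensus σ a₀ θ₀ u₀ N Φ u E + eventCount σ a₀ θ₀ u₀ N Φ u r' (upEvent E) →
      AEMeasurable (eventSum Φ u r' (mergeEvent E Δ)) (localGibbsLaw σ a₀ u₀ θ₀ N Φ) →
      AEMeasurable (eventSum Φ u r' (tailEvent (4 * E))) (localGibbsLaw σ a₀ u₀ θ₀ N Φ) →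
      (∀ K : ℕ,
        C₁ * Real.sqrt E * (nhi (E - Δ) - nE)
          + A * Real.sqrt E / ((N : ℝ) + 1) *
              ((∑ k ∈ Finset.Icc 1 ⌈E / (2 * Δ)⌉₊, nhi (E - ((k : ℝ) + 1) * Δ) * nhi ((k : ℝ) * Δ))
                + ∑ j ∈ Finset.range (⌈E / Δ⌉₊ + 1),
                    nhi (((j : ℝ) - 1) * Δ) * nhi (2 * E - ((j : ℝ) + 1) * Δ))
          + C₁ * ∑ k ∈ Finset.range K, Real.sqrt (2 ^ (k + 1) * (4 * E)) * nhi (2 ^ k * (4 * E))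
        ≤ c * Real.sqrt E * (nE - nhi (3 / 2 * E))) →
      (levelCensus σ a₀ θ₀ u₀ N Φ r' E).toReal ≤ (levelCensus σ a₀ θ₀ u₀ N Φ u E).toReal := by
  intro σ a₀ θ₀ u₀ N Φ C₁ A c κ E Δ u r' nE nhi hP hC₁ hA hc hκ hur hE hΔ hΔE h0 hnhi hnE hshell hmerge
    htl hsplit hled hmT hmV hsuper
  -- notation
  set M : ℝ := (N : ℝ) + 1 with hM
  set h : ℝ := r' - u with hh
  have hh0 : 0 < h := by rw [hh]; linarith
  have hM0 : 0 < M := by rw [hM]; positivity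
  set PAIRS : ℝ := (∑ k ∈ Finset.Icc 1 ⌈E / (2 * Δ)⌉₊, nhi (E - ((k : ℝ) + 1) * Δ) * nhi ((k : ℝ) * Δ))
      + ∑ j ∈ Finset.range (⌈E / Δ⌉₊ + 1), nhi (((j : ℝ) - 1) * Δ) * nhi (2 * E - ((j : ℝ) + 1) * Δ)
    with hPAIRS
  set band : ℝ := C₁ * Real.sqrt E * (nhi (E - Δ) - nE) with hband
  set pairs : ℝ := A * Real.sqrt E / M * PAIRS with hpairs
  set decay : ℝ := c * Real.sqrt E * (nE - nhi (3 / 2 * E)) with hdecay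
  set TAIL : ℝ := (decay - band - pairs) / C₁ with hTAIL
  have hPAIRS0 : 0 ≤ PAIRS := add_nonneg (Finset.sum_nonneg fun k _ => mul_nonneg (h0 _) (h0 _))
    (Finset.sum_nonneg fun j _ => mul_nonneg (h0 _) (h0 _))
  have huI : u ∈ Set.Icc u r' := ⟨le_rfl, hur.le⟩
  -- the band is nonnegative: `nE ≤ n_u(E) ≤ n_u(E−Δ) ≤ nhi(E−Δ)`
  have hband0 : 0 ≤ nhi (E - Δ) - nE := by
    have h1 := hnE u huI
    have h2 := hnhi u huI (E - Δ)
    have h3 : (levelCensus σ a₀ θ₀ u₀ N Φ u E).toReal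
        ≤ (levelCensus σ a₀ θ₀ u₀ N Φ u (E - Δ)).toReal :=
      ENNReal.toReal_mono (levelCensus_ne_top Φ u _) (levelCensus_antitone Φ u (by linarith))
    linarith
  have hTAIL0 : 0 ≤ TAIL := by
    have h1 := hsuper 0
    rw [Finset.sum_range_zero, mul_zero, add_zero] at h1
    rw [hTAIL]; exact div_nonneg (by linarith) hC₁.le
  have hpart : ∀ K : ℕ,
      ∑ k ∈ Finset.range K, Real.sqrt (2 ^ (k + 1) * (4 * E)) * nhi (2 ^ k * (4 * E)) ≤ TAIL := by
    intro K
    have h1 := hsuper K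
    rw [hTAIL, le_div_iff₀ hC₁]
    linarith
  -- (U) up-crossings split into the three accounts
  have hU : eventCount σ a₀ θ₀ u₀ N Φ u r' (upEvent E)
      ≤ eventCount σ a₀ θ₀ u₀ N Φ u r' (shellEvent (E - Δ) E)
        + eventCount σ a₀ θ₀ u₀ N Φ u r' (mergeEvent E Δ)
        + eventCount σ a₀ θ₀ u₀ N Φ u r' (tailEvent (4 * E)) :=
    (eventCount_mono σ a₀ θ₀ u₀ N Φ u r' _ _ (upEvent_subset_accounts E Δ)).trans
      (eventCount_union₃_le Φ u r' _ _ _ hmT hmV)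
  -- band flux
  have hUb : eventCount σ a₀ θ₀ u₀ N Φ u r' (shellEvent (E - Δ) E)
      ≤ ENNReal.ofReal (C₁ * κ * Real.sqrt E * h * (nhi (E - Δ) - nE)) := by
    refine flux_le_of_iSup_le (by positivity) hshell fun r hr => ?_
    refine le_ofReal_of_toReal_le (shellCensus_ne_top Φ r _ _) ?_
    rw [shellCensus_toReal_eq Φ r (show E - Δ ≤ E by linarith)]
    linarith [hnhi r hr (E - Δ), hnE r hr]
  -- merge flux
  have hUm : eventCount σ a₀ θ₀ u₀ N Φ u r' (mergeEvent E Δ)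
      ≤ ENNReal.ofReal (A * κ * Real.sqrt E * h / M * PAIRS) := by
    refine flux_le_of_iSup_le (by positivity) hmerge fun r hr => ?_
    exact pairMajorant_le_ofReal Φ r E Δ h0 fun E' =>
      le_ofReal_of_toReal_le (levelCensus_ne_top Φ r _) (hnhi r hr E')
  -- tail flux
  have hUt : eventCount σ a₀ θ₀ u₀ N Φ u r' (tailEvent (4 * E))
      ≤ ENNReal.ofReal (C₁ * κ * h * TAIL) := by
    refine flux_le_of_iSup_le (by positivity) htl fun r hr => ?_
    exact speedCensus_le_ofReal_of_partial Φ r (by linarith) h0 (hnhi r hr) hpart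
  -- decay flux
  have hD : ENNReal.ofReal (c * κ * Real.sqrt E * h * (nE - nhi (3 / 2 * E)))
      ≤ eventCount σ a₀ θ₀ u₀ N Φ u r' (downEvent E) := by
    refine (ofReal_le_flux_of_le_iInf (by positivity) hsplit fun r hr => ?_).trans
      (eventCount_mono σ a₀ θ₀ u₀ N Φ u r' _ _ (splitEvent_subset_downEvent E))
    refine ofReal_le_of_le_toReal (shellCensus_ne_top Φ r _ _) ?_
    rw [shellCensus_toReal_eq Φ r (show E ≤ 3 / 2 * E by linarith)]
    linarith [hnhi r hr (3 / 2 * E), hnE r hr]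
  -- the real identity: band + pairs + C₁ TAIL = decay (times κ h)
  have hkey : C₁ * κ * Real.sqrt E * h * (nhi (E - Δ) - nE) + A * κ * Real.sqrt E * h / M * PAIRS
      + C₁ * κ * h * TAIL = c * κ * Real.sqrt E * h * (nE - nhi (3 / 2 * E)) := by
    rw [hTAIL, hdecay, hband, hpairs]
    field_simp
    ring
  have hUD : eventCount σ a₀ θ₀ u₀ N Φ u r' (upEvent E)
      ≤ eventCount σ a₀ θ₀ u₀ N Φ u r' (downEvent E) := by
    refine hU.trans ((add_le_add (add_le_add hUb hUm) hUt).trans ?_)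
    rw [← ENNReal.ofReal_add (by positivity) (by positivity),
      ← ENNReal.ofReal_add (by positivity) (by positivity), hkey]
    exact hD
  -- the ledger: `n_{r'} + D = n_u + U ≤ n_u + D`, cancel the finite `D`
  have hUfin : eventCount σ a₀ θ₀ u₀ N Φ u r' (upEvent E) ≠ ⊤ := by
    refine (lt_of_le_of_lt hU ?_).ne
    refine ENNReal.add_lt_top.2 ⟨ENNReal.add_lt_top.2 ⟨?_, ?_⟩, ?_⟩
    · exact lt_of_le_of_lt hUb ENNReal.ofReal_lt_top
    · exact lt_of_le_of_lt hUm ENNReal.ofReal_lt_top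
    · exact lt_of_le_of_lt hUt ENNReal.ofReal_lt_top
  have hDtop : eventCount σ a₀ θ₀ u₀ N Φ u r' (downEvent E) ≠ ⊤ := by
    intro htop
    rw [htop, add_top] at hled
    exact absurd hled.symm (ENNReal.add_ne_top.2 ⟨levelCensus_ne_top Φ u E, hUfin⟩)
  have hle : levelCensus σ a₀ θ₀ u₀ N Φ r' E + eventCount σ a₀ θ₀ u₀ N Φ u r' (downEvent E)
      ≤ levelCensus σ a₀ θ₀ u₀ N Φ u E + eventCount σ a₀ θ₀ u₀ N Φ u r' (downEvent E) := by
    rw [hled]; exact add_le_add le_rfl hUD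
  exact ENNReal.toReal_mono (levelCensus_ne_top Φ u E)
    ((ENNReal.add_le_add_iff_right hDtop).1 hle)

/-! ## The upward Lipschitz bound of the census -/

/-- **Upward time-Lipschitz bound of the census (`∀`-form).**  On a window `(r, r']` at a level
`E > 0` (`0 < Δ ≤ E`), the crossing ledger and the crude up-crossing fluxes (F1 shell and tail,
F2 merge, with census `≤ N+1`, pair majorant `≤ (N+1)² · #classes`, speed census
`≤ (N+1) m₂/(2√E)`) give `n_{r'}(E) ≤ n_r(E) + K (r' − r)` for any `K` above the crude rate. -/
theorem closure_hlip :
    ∀ (σ : ℝ) (a₀ θ₀ : T3 → ℝ) (u₀ : T3 → V3) (N : ℕ) (Φ : Flow σ N)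
      (C₁ A κ m₂ E Δ r r' K : ℝ),
      IsProbabilityMeasure (localGibbsLaw σ a₀ u₀ θ₀ N Φ) →
      0 ≤ C₁ → 0 ≤ A → 0 ≤ κ → 0 ≤ m₂ → r ≤ r' → 0 < E → 0 < Δ →
      (∀ r'' ∈ Set.Icc r r',
        kineticEnergy σ a₀ θ₀ u₀ N Φ r'' ≤ ENNReal.ofReal (((N : ℝ) + 1) * m₂)) →
      eventCount σ a₀ θ₀ u₀ N Φ r r' (shellEvent (E - Δ) E)
        ≤ ENNReal.ofReal (C₁ * κ * Real.sqrt E * (r' - r)) *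
            ⨆ r'' ∈ Set.Icc r r', shellCensus σ a₀ θ₀ u₀ N Φ r'' (E - Δ) E →
      eventCount σ a₀ θ₀ u₀ N Φ r r' (mergeEvent E Δ)
        ≤ ENNReal.ofReal (A * κ * Real.sqrt E * (r' - r) / ((N : ℝ) + 1)) *
            ⨆ r'' ∈ Set.Icc r r', pairMajorant σ a₀ θ₀ u₀ N Φ r'' E Δ →
      eventCount σ a₀ θ₀ u₀ N Φ r r' (tailEvent (4 * E))
        ≤ ENNReal.ofReal (C₁ * κ * (r' - r)) *
            ⨆ r'' ∈ Set.Icc r r', speedCensus σ a₀ θ₀ u₀ N Φ r'' (4 * E) →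
      levelCensus σ a₀ θ₀ u₀ N Φ r' E + eventCount σ a₀ θ₀ u₀ N Φ r r' (downEvent E)
        = levelCensus σ a₀ θ₀ u₀ N Φ r E + eventCount σ a₀ θ₀ u₀ N Φ r r' (upEvent E) →
      AEMeasurable (eventSum Φ r r' (mergeEvent E Δ)) (localGibbsLaw σ a₀ u₀ θ₀ N Φ) →
      AEMeasurable (eventSum Φ r r' (tailEvent (4 * E))) (localGibbsLaw σ a₀ u₀ θ₀ N Φ) →
      κ * (C₁ * Real.sqrt E * ((N : ℝ) + 1)
          + A * Real.sqrt E * ((N : ℝ) + 1) * (⌈E / (2 * Δ)⌉₊ + ⌈E / Δ⌉₊ + 1)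
          + C₁ * ((N : ℝ) + 1) * m₂ / (2 * Real.sqrt E)) ≤ K →
      (levelCensus σ a₀ θ₀ u₀ N Φ r' E).toReal
        ≤ (levelCensus σ a₀ θ₀ u₀ N Φ r E).toReal + K * (r' - r) := by
  intro σ a₀ θ₀ u₀ N Φ C₁ A κ m₂ E Δ r r' K hP hC₁ hA hκ hm₂ hrr' hE hΔ hkin hshell hmerge htl hled
    hmT hmV hK
  set M : ℝ := (N : ℝ) + 1 with hM
  set h : ℝ := r' - r with hh
  have hh0 : 0 ≤ h := by rw [hh]; linarith
  have hM0 : 0 < M := by rw [hM]; positivity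
  have hsE : 0 < Real.sqrt E := Real.sqrt_pos.2 hE
  set T : ℝ := (⌈E / (2 * Δ)⌉₊ : ℝ) + ⌈E / Δ⌉₊ + 1 with hT
  have hT0 : 0 ≤ T := by rw [hT]; positivity
  -- every census is at most `M`
  have hlevM : ∀ r'' E', levelCensus σ a₀ θ₀ u₀ N Φ r'' E' ≤ ENNReal.ofReal M := by
    intro r'' E'
    rw [hM, ← natCast_succ_eq_ofReal]
    exact levelCensus_le_card Φ r'' E'
  -- (U) split
  have hU : eventCount σ a₀ θ₀ u₀ N Φ r r' (upEvent E)
      ≤ eventCount σ a₀ θ₀ u₀ N Φ r r' (shellEvent (E - Δ) E)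
        + eventCount σ a₀ θ₀ u₀ N Φ r r' (mergeEvent E Δ)
        + eventCount σ a₀ θ₀ u₀ N Φ r r' (tailEvent (4 * E)) :=
    (eventCount_mono σ a₀ θ₀ u₀ N Φ r r' _ _ (upEvent_subset_accounts E Δ)).trans
      (eventCount_union₃_le Φ r r' _ _ _ hmT hmV)
  have hUb : eventCount σ a₀ θ₀ u₀ N Φ r r' (shellEvent (E - Δ) E)
      ≤ ENNReal.ofReal (C₁ * κ * Real.sqrt E * h * M) :=
    flux_le_of_iSup_le (by positivity) hshell fun r'' _ =>
      (shellCensus_le_levelCensus Φ r'' _ _).trans (hlevM r'' _)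
  have hUm : eventCount σ a₀ θ₀ u₀ N Φ r r' (mergeEvent E Δ)
      ≤ ENNReal.ofReal (A * κ * Real.sqrt E * h / M * (M * M * T)) := by
    refine flux_le_of_iSup_le (by positivity) hmerge fun r'' _ => ?_
    refine (pairMajorant_le_ofReal Φ r'' E Δ (nhi := fun _ => M) (fun _ => hM0.le)
      (fun E' => hlevM r'' E')).trans (le_of_eq ?_)
    congr 1
    simp only [Finset.sum_const, Nat.card_Icc, Finset.card_range, hT]
    push_cast
    ring
  have hUt : eventCount σ a₀ θ₀ u₀ N Φ r r' (tailEvent (4 * E))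
      ≤ ENNReal.ofReal (C₁ * κ * h * (M * m₂ / (2 * Real.sqrt E))) := by
    refine flux_le_of_iSup_le (by positivity) htl fun r'' hr'' => ?_
    have h4 : Real.sqrt (4 * E) = 2 * Real.sqrt E := by
      rw [Real.sqrt_mul (by norm_num : (0 : ℝ) ≤ 4), show (4 : ℝ) = 2 ^ 2 by norm_num,
        Real.sqrt_sq (by norm_num : (0 : ℝ) ≤ 2)]
    calc speedCensus σ a₀ θ₀ u₀ N Φ r'' (4 * E)
        ≤ ENNReal.ofReal ((Real.sqrt (4 * E))⁻¹) * kineticEnergy σ a₀ θ₀ u₀ N Φ r'' :=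
          speedCensus_le_kineticEnergy Φ r'' (by linarith)
      _ ≤ ENNReal.ofReal ((Real.sqrt (4 * E))⁻¹) * ENNReal.ofReal (M * m₂) :=
          mul_le_mul' le_rfl (hkin r'' hr'')
      _ = ENNReal.ofReal (M * m₂ / (2 * Real.sqrt E)) := by
          rw [← ENNReal.ofReal_mul (inv_nonneg.2 (Real.sqrt_nonneg _)), h4]
          congr 1; field_simp
  -- combine
  have hrate : C₁ * κ * Real.sqrt E * h * M + A * κ * Real.sqrt E * h / M * (M * M * T)
      + C₁ * κ * h * (M * m₂ / (2 * Real.sqrt E))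
      = h * (κ * (C₁ * Real.sqrt E * M + A * Real.sqrt E * M * T + C₁ * M * m₂ / (2 * Real.sqrt E))) := by
    field_simp
  have hUle : eventCount σ a₀ θ₀ u₀ N Φ r r' (upEvent E) ≤ ENNReal.ofReal (h * K) := by
    refine hU.trans ((add_le_add (add_le_add hUb hUm) hUt).trans ?_)
    rw [← ENNReal.ofReal_add (by positivity) (by positivity),
      ← ENNReal.ofReal_add (by positivity) (by positivity), hrate]
    exact ENNReal.ofReal_le_ofReal (mul_le_mul_of_nonneg_left hK hh0)
  -- ledger
  have h1 : levelCensus σ a₀ θ₀ u₀ N Φ r' E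
      ≤ levelCensus σ a₀ θ₀ u₀ N Φ r E + ENNReal.ofReal (h * K) :=
    calc levelCensus σ a₀ θ₀ u₀ N Φ r' E
        ≤ levelCensus σ a₀ θ₀ u₀ N Φ r' E + eventCount σ a₀ θ₀ u₀ N Φ r r' (downEvent E) :=
          le_self_add
      _ = levelCensus σ a₀ θ₀ u₀ N Φ r E + eventCount σ a₀ θ₀ u₀ N Φ r r' (upEvent E) := hled
      _ ≤ levelCensus σ a₀ θ₀ u₀ N Φ r E + ENNReal.ofReal (h * K) := add_le_add le_rfl hUle
  have hK0 : 0 ≤ h * K := by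
    have : 0 ≤ κ * (C₁ * Real.sqrt E * M + A * Real.sqrt E * M * T
        + C₁ * M * m₂ / (2 * Real.sqrt E)) := by positivity
    exact mul_nonneg hh0 (this.trans hK)
  have h2 := ENNReal.toReal_mono (ENNReal.add_ne_top.2 ⟨levelCensus_ne_top Φ r E,
    ENNReal.ofReal_ne_top⟩) h1
  rw [ENNReal.toReal_add (levelCensus_ne_top Φ r E) ENNReal.ofReal_ne_top,
    ENNReal.toReal_ofReal hK0] at h2
  linarith [mul_comm h K]

end Summit.AtomisticToContinuum.HydrodynamicLimit.Theorems.EnergyCurrentTailsLevelCensus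

end
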